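import Summits.CriticalPhenomena.PercolationContinuityZ3.Theorems.PercNearOneGluingNoHeavyLowerTailSahiTwoChainUnions
import Literature.Probability.LatticeModels.ProdBernoulliIndependence
import HarnessLib

/-!
# The increasing star — and Sahi positivity of EVERY order — for the root-cluster events of a weighted CYCLE

Support file for the Sahi programme (`--supports stmt-CriticalPhenomena-4575`, prover prim-sahi-p2 gen 8).
No definitions, no named facts, no sorries; standard axioms.  Memo
`run/shared/lean/prim/prim-sahi/prim-sahi-p2/PROOF-E3.md` §19.

**Setting.**  Bernoulli bond percolation `prodBernoulli w` on `Fin m` (`m ≥ 3`), where the weight `w` vanishes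
off the cycle edges `s(j, j+1)` (`j : Fin m`, addition mod `m`): the cycle `C_m` with ARBITRARY edge weights;
root `0`.  The two ARC EVENTS of a vertex `v` are
`{ω | ∀ j, j < v → s(j, j+1) ∈ ω}` (right arc `0–1–⋯–v` open; shrinks as `v` grows) and
`{ω | ∀ j, v ≤ j → s(j, j+1) ∈ ω}` (left arc `v–(v+1)–⋯–(m−1)–0` open; grows with `v`).

**Theorem `sahiE_rootCluster_cycle_nonneg`.**  For every `n` and all targets `t₀,…,t_{n−1} : Fin m`
(repetitions and the root itself allowed), Sahi's functional of the root-connection events is nonnegative: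
`0 ≤ E_n(1_{0↔t₀}, …, 1_{0↔t_{n−1}})`.  In particular (`incStar_cycle_nonneg`) the INCREASING STAR
`0 ≤ E₃({0↔b},{0↔c},{0↔y}) = sahiE3 (prodBernoulli w) (openConn 0 b) (openConn 0 c) (openConn 0 y)` holds on
every weighted cycle — an infinite family of graphs that are not forests on which the open four-point
functional of this programme (memo §15) is now a theorem; censuses had it for cycles of length `≤ 7`
(CENSUS.md §13) and, as a fibre certificate, for three pair targets on `C₈` (ttrl2 FKCONN.md §8).
Any root is covered by relabelling the cycle.

**Proof.**  On configurations of positive weight (no weight-`0` pair open), `{0 ↔ v}` is the union of the two arc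
events (`openConn_iff_arcs`: open arcs are open walks; conversely a boundary dart of an open walk from `0` to
`v` cannot leave the vertex interval between a closed right-arc edge and a closed left-arc edge); for `v ≤ v'`
the complements of the right arc to `v` and of the left arc to `v'` are determined by disjoint edge sets, hence
independent; so `TwoChainUnions.sahiE_nonneg_of_twoChainUnions` applies (Sahi positivity of the product of the
two arc-length laws, transported along avoidance moments — the joint law of the two arc lengths is not a
product law).  Configurations of weight `0` contribute to no moment, which transfers the statement from the arc
events to the connection events (`TwoChainUnions.sahiE_congr_of_prodMoments`).
-/

noncomputable section

namespace Summit.CriticalPhenomena.PercolationContinuityZ3.Theorems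

namespace IncStarCycle

open Finset MeasureTheory Literature.Combinatorics.Sahi2008 Literature.Probability.Percolation
  Literature.Probability.LatticeModels
open Literature.Probability.Percolation.DecisionTree (ind ind_of_mem ind_of_not_mem ind_nonneg)
open Literature.Probability.Percolation.BHK2006 (weight)
open scoped Classical

variable {m : ℕ} [NeZero m]

/-! ### The successor `j ↦ j + 1` on `Fin m` -/

/-- Value of `j + 1` away from the last vertex. [folklore] -/
theorem val_succ_of_lt {j : Fin m} (h : j.val + 1 < m) : (j + 1 : Fin m).val = j.val + 1 := by
  rw [Fin.val_add, Fin.val_one', Nat.mod_eq_of_lt (show 1 < m by omega), Nat.mod_eq_of_lt h]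

/-- `j + 1 = 0` at the last vertex. [folklore] -/
theorem val_succ_of_not_lt {j : Fin m} (h : ¬ j.val + 1 < m) : (j + 1 : Fin m).val = 0 := by
  have hj : j.val + 1 = m := by have := j.isLt; omega
  rw [Fin.val_add, Fin.val_one']
  rcases Nat.lt_or_ge 1 m with h1 | h1
  · rw [Nat.mod_eq_of_lt h1, hj, Nat.mod_self]
  · have : m = 1 := by have := NeZero.pos m; omega
    subst this
    simp

/-! ### Open arcs connect the root to the target -/

/-- If the right arc `0–1–⋯–v` is open then `0 ↔ v`. [this work] -/
theorem reachable_of_rightArc {v : Fin m} {ω : BondConfig (Fin m)}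
    (hω : ∀ j : Fin m, j.val < v.val → s(j, j + 1) ∈ ω) : (openGraph ω).Reachable (0 : Fin m) v := by
  suffices h : ∀ k : ℕ, ∀ hk : k < m, k ≤ v.val → (openGraph ω).Reachable (0 : Fin m) ⟨k, hk⟩ by
    have := h v.val v.isLt le_rfl
    simpa using this
  intro k
  induction k with
  | zero => intro hk _; exact SimpleGraph.Reachable.refl _
  | succ k ih =>
    intro hk hkv
    have hk' : k < m := by omega
    refine (ih hk' (by omega)).trans (SimpleGraph.Adj.reachable ?_)
    rw [openGraph_adj]
    refine ⟨?_, ?_⟩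
    · have hmem := hω ⟨k, hk'⟩ (by simpa using hkv)
      have hn : ((⟨k, hk'⟩ : Fin m) + 1) = ⟨k + 1, hk⟩ := Fin.ext (by rw [val_succ_of_lt (by simpa using hk)])
      simpa [hn] using hmem
    · simp

/-- If the left arc `v–(v+1)–⋯–(m−1)–0` is open (`m ≥ 2`) then `0 ↔ v`. [this work] -/
theorem reachable_of_leftArc (hm : 2 ≤ m) {v : Fin m} {ω : BondConfig (Fin m)}
    (hω : ∀ j : Fin m, v.val ≤ j.val → s(j, j + 1) ∈ ω) : (openGraph ω).Reachable (0 : Fin m) v := by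
  -- go from `v` forward to `m − 1` and then over the edge `{m−1, 0}`
  suffices h : ∀ d k : ℕ, ∀ hk : k < m, k + d + 1 = m → v.val ≤ k →
      (openGraph ω).Reachable (⟨k, hk⟩ : Fin m) 0 by
    have := h (m - 1 - v.val) v.val v.isLt (by omega) le_rfl
    simpa using this.symm
  intro d
  induction d with
  | zero =>
    intro k hk hkd hvk
    refine SimpleGraph.Adj.reachable ?_
    rw [openGraph_adj]
    have hmem := hω ⟨k, hk⟩ (by simpa using hvk)
    have hn : ((⟨k, hk⟩ : Fin m) + 1) = 0 := Fin.ext (by rw [val_succ_of_not_lt (by simp; omega)]; simp)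
    refine ⟨by simpa [hn] using hmem, ?_⟩
    intro h0
    have := congrArg Fin.val h0
    simp at this
    omega
  | succ d ih =>
    intro k hk hkd hvk
    have hk1 : k + 1 < m := by omega
    refine SimpleGraph.Reachable.trans (SimpleGraph.Adj.reachable ?_) (ih (k + 1) hk1 (by omega) (by omega))
    rw [openGraph_adj]
    have hmem := hω ⟨k, hk⟩ (by simpa using hvk)
    have hn : ((⟨k, hk⟩ : Fin m) + 1) = ⟨k + 1, hk1⟩ := Fin.ext (by rw [val_succ_of_lt (by simpa using hk1)])
    refine ⟨by simpa [hn] using hmem, ?_⟩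
    intro h0
    have := congrArg Fin.val h0
    simp at this

/-! ### Conversely: if both arcs are broken, the target is cut off from the root -/

/-- An open edge of the form `s(k, k+1)` cannot leave the vertex interval `(i, j]` when the edges `s(i, i+1)` and
`s(j, j+1)` are closed (the closure step of the boundary argument). [this work] -/
theorem arcInterval_closed {ω : BondConfig (Fin m)} {i j : Fin m} (hi : s(i, i + 1) ∉ ω) (hj : s(j, j + 1) ∉ ω)
    {u u' : Fin m} (hadj : (openGraph ω).Adj u u') (hcyc : ∃ k : Fin m, s(u, u') = s(k, k + 1))
    (hu : i.val < u.val ∧ u.val ≤ j.val) : i.val < u'.val ∧ u'.val ≤ j.val := by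
  rw [openGraph_adj] at hadj
  obtain ⟨k, hk⟩ := hcyc
  have hkω : s(k, k + 1) ∈ ω := hk ▸ hadj.1
  have hki : k ≠ i := fun h => hi (h ▸ hkω)
  have hkj : k ≠ j := fun h => hj (h ▸ hkω)
  rw [Sym2.eq_iff] at hk
  rcases hk with ⟨hu1, hu2⟩ | ⟨hu1, hu2⟩
  · -- `u = k`, `u' = k + 1`
    rw [hu2]
    rw [hu1] at hu
    by_cases hlt : k.val + 1 < m
    · rw [val_succ_of_lt hlt]
      have : k.val ≠ j.val := fun h => hkj (Fin.ext h)
      omega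
    · exfalso
      have : k.val = j.val := by have := j.isLt; omega
      exact hkj (Fin.ext this)
  · -- `u = k + 1`, `u' = k`
    rw [hu2]
    rw [hu1] at hu
    by_cases hlt : k.val + 1 < m
    · rw [val_succ_of_lt hlt] at hu
      have : k.val ≠ i.val := fun h => hki (Fin.ext h)
      omega
    · rw [val_succ_of_not_lt hlt] at hu
      omega

/-- **Cut-off.**  If every open edge of `ω` is a cycle edge, some right-arc edge `s(i,i+1)`, `i < v`, is closed and some
left-arc edge `s(j,j+1)`, `v ≤ j`, is closed, then `0 ↮ v`. [this work] -/
theorem not_reachable_of_arcs_broken {ω : BondConfig (Fin m)}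
    (hω : ∀ u u' : Fin m, (openGraph ω).Adj u u' → ∃ k : Fin m, s(u, u') = s(k, k + 1))
    {v i j : Fin m} (hiv : i.val < v.val) (hi : s(i, i + 1) ∉ ω) (hvj : v.val ≤ j.val) (hj : s(j, j + 1) ∉ ω) :
    ¬ (openGraph ω).Reachable (0 : Fin m) v := by
  rintro ⟨p⟩
  -- the vertex interval `(i, j]` contains `v` but not `0`, and no open edge leaves it
  set S : Set (Fin m) := {u | i.val < u.val ∧ u.val ≤ j.val} with hS
  have h0 : (0 : Fin m) ∈ Sᶜ := by simp [hS]
  have hv : v ∉ Sᶜ := by simp [hS]; exact ⟨hiv, hvj⟩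
  obtain ⟨d, -, hd1, hd2⟩ := p.exists_boundary_dart Sᶜ h0 hv
  have hd2' : d.toProd.2 ∈ S := by simpa using hd2
  exact hd1 (arcInterval_closed hi hj d.adj.symm (hω _ _ d.adj.symm) hd2')

/-- **The root-cluster events of a cycle are unions of two arcs**: if every open edge of `ω` is a cycle edge
(`m ≥ 2`) then `0 ↔ v` iff the right arc or the left arc to `v` is open. [this work] -/
theorem openConn_iff_arcs (hm : 2 ≤ m) {ω : BondConfig (Fin m)}
    (hω : ∀ u u' : Fin m, (openGraph ω).Adj u u' → ∃ k : Fin m, s(u, u') = s(k, k + 1)) (v : Fin m) :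
    ω ∈ openConn (0 : Fin m) v ↔
      ω ∈ {ω : BondConfig (Fin m) | ∀ j : Fin m, j.val < v.val → s(j, j + 1) ∈ ω} ∪
        {ω | ∀ j : Fin m, v.val ≤ j.val → s(j, j + 1) ∈ ω} := by
  constructor
  · intro h
    by_contra hne
    simp only [Set.mem_union, Set.mem_setOf_eq, not_or, not_forall] at hne
    obtain ⟨⟨i, hiv, hi⟩, ⟨j, hvj, hj⟩⟩ := hne
    exact not_reachable_of_arcs_broken hω hiv hi hvj hj h
  · rintro (h | h)
    · exact reachable_of_rightArc h
    · exact reachable_of_leftArc hm h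

/-! ### Independence of complementary arcs -/

/-- The complement of the right arc to `v` is determined by the edges `s(j, j+1)`, `j < v`. [this work] -/
theorem determinedBy_rightArc_compl (v : Fin m) :
    DeterminedBy {ω : BondConfig (Fin m) | ∀ j : Fin m, j.val < v.val → s(j, j + 1) ∈ ω}ᶜ
      (↑((univ.filter fun j : Fin m => j.val < v.val).image fun j : Fin m => s(j, j + 1)) : Set (Sym2 (Fin m))) := by
  rw [determinedBy_iff]
  intro ω ω' h
  have key : ∀ j : Fin m, j.val < v.val → (s(j, j + 1) ∈ ω ↔ s(j, j + 1) ∈ ω') := by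
    intro j hj
    have hmem : s(j, j + 1) ∈ (↑((univ.filter fun j : Fin m => j.val < v.val).image
        fun j : Fin m => s(j, j + 1)) : Set (Sym2 (Fin m))) := by
      simp only [coe_image, coe_filter, mem_univ, true_and, Set.mem_image, Set.mem_setOf_eq]
      exact ⟨j, hj, rfl⟩
    constructor
    · intro hω; exact ((Set.ext_iff.1 h _).1 ⟨hω, hmem⟩).1
    · intro hω'; exact ((Set.ext_iff.1 h _).2 ⟨hω', hmem⟩).1
  simp only [Set.mem_compl_iff, Set.mem_setOf_eq]
  exact not_congr (forall_congr' fun j => imp_congr_right fun hj => key j hj)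

/-- The complement of the left arc to `v` is determined by the edges `s(j, j+1)`, `v ≤ j`. [this work] -/
theorem determinedBy_leftArc_compl (v : Fin m) :
    DeterminedBy {ω : BondConfig (Fin m) | ∀ j : Fin m, v.val ≤ j.val → s(j, j + 1) ∈ ω}ᶜ
      (↑((univ.filter fun j : Fin m => v.val ≤ j.val).image fun j : Fin m => s(j, j + 1)) : Set (Sym2 (Fin m))) := by
  rw [determinedBy_iff]
  intro ω ω' h
  have key : ∀ j : Fin m, v.val ≤ j.val → (s(j, j + 1) ∈ ω ↔ s(j, j + 1) ∈ ω') := by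
    intro j hj
    have hmem : s(j, j + 1) ∈ (↑((univ.filter fun j : Fin m => v.val ≤ j.val).image
        fun j : Fin m => s(j, j + 1)) : Set (Sym2 (Fin m))) := by
      simp only [coe_image, coe_filter, mem_univ, true_and, Set.mem_image, Set.mem_setOf_eq]
      exact ⟨j, hj, rfl⟩
    constructor
    · intro hω; exact ((Set.ext_iff.1 h _).1 ⟨hω, hmem⟩).1
    · intro hω'; exact ((Set.ext_iff.1 h _).2 ⟨hω', hmem⟩).1
  simp only [Set.mem_compl_iff, Set.mem_setOf_eq]
  exact not_congr (forall_congr' fun j => imp_congr_right fun hj => key j hj)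

/-- On a cycle of length `≥ 3` the edge map `j ↦ s(j, j+1)` is injective. [folklore] -/
theorem cycEdge_injective (hm : 3 ≤ m) : Function.Injective fun j : Fin m => s(j, j + 1) := by
  intro j k hjk
  simp only at hjk
  rw [Sym2.eq_iff] at hjk
  rcases hjk with ⟨h, -⟩ | ⟨h1, h2⟩
  · exact h
  · -- `j = k + 1` and `j + 1 = k`: impossible for `m ≥ 3`
    exfalso
    have hv1 := congrArg Fin.val h1
    have hv2 := congrArg Fin.val h2
    by_cases hj : j.val + 1 < m <;> by_cases hk : k.val + 1 < m
    · rw [val_succ_of_lt hk] at hv1; rw [val_succ_of_lt hj] at hv2; omega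
    · rw [val_succ_of_not_lt hk] at hv1; rw [val_succ_of_lt hj] at hv2; omega
    · rw [val_succ_of_lt hk] at hv1; rw [val_succ_of_not_lt hj] at hv2; omega
    · rw [val_succ_of_not_lt hk] at hv1; rw [val_succ_of_not_lt hj] at hv2
      have := j.isLt; have := k.isLt; omega

/-- For `v ≤ v'` the complements of the right arc to `v` and of the left arc to `v'` are independent
(disjoint edge sets). [this work] -/
theorem real_rightArc_compl_inter_leftArc_compl (hm : 3 ≤ m) (w : Sym2 (Fin m) → unitInterval)
    {v v' : Fin m} (hvv' : v ≤ v') :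
    (prodBernoulli w).real
        ({ω : BondConfig (Fin m) | ∀ j : Fin m, j.val < v.val → s(j, j + 1) ∈ ω}ᶜ ∩
          {ω | ∀ j : Fin m, v'.val ≤ j.val → s(j, j + 1) ∈ ω}ᶜ) =
      (prodBernoulli w).real {ω : BondConfig (Fin m) | ∀ j : Fin m, j.val < v.val → s(j, j + 1) ∈ ω}ᶜ *
        (prodBernoulli w).real {ω : BondConfig (Fin m) | ∀ j : Fin m, v'.val ≤ j.val → s(j, j + 1) ∈ ω}ᶜ := by
  refine prodBernoulli_real_inter_of_determinedBy_disjoint w ?_ (determinedBy_rightArc_compl v)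
    (determinedBy_leftArc_compl v') MeasurableSet.of_discrete MeasurableSet.of_discrete
  rw [Finset.disjoint_left]
  intro e he he'
  simp only [mem_image, mem_filter, mem_univ, true_and] at he he'
  obtain ⟨j, hj, rfl⟩ := he
  obtain ⟨k, hk, hjk⟩ := he'
  have := cycEdge_injective hm hjk
  subst this
  have := Fin.le_def.1 hvv'
  omega

/-! ### The theorem -/

/-- Configurations containing a weight-`0` coordinate have weight `0`. [folklore] -/
theorem bernoulliWeight_eq_zero_of_mem {ι : Type*} [Fintype ι] (p : ι → unitInterval) {ω : Set ι} {e : ι}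
    (he : e ∈ ω) (hp : p e = 0) : bernoulliWeight p ω = 0 := by
  unfold bernoulliWeight weight
  exact Finset.prod_eq_zero (Finset.mem_univ e) (by simp [he, hp])

/-- **Sahi positivity of every order for the root-cluster events of a weighted cycle.**  Let `m ≥ 3` and let the
weight `w` on the pairs of `Fin m` vanish off the cycle edges `s(j, j+1)`.  Then for every `n` and all targets
`t : Fin n → Fin m`, `0 ≤ E_n(1_{0↔t 0}, …, 1_{0↔t (n−1)})` under the product weight `bernoulliWeight w`
(the point masses of `prodBernoulli w`). [this work] -/
theorem sahiE_rootCluster_cycle_nonneg (hm : 3 ≤ m) (w : Sym2 (Fin m) → unitInterval)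
    (hw : ∀ e : Sym2 (Fin m), (∀ j : Fin m, e ≠ s(j, j + 1)) → w e = 0) (n : ℕ) (t : Fin n → Fin m) :
    0 ≤ sahiE (bernoulliWeight w) n (fun i => ind (openConn (0 : Fin m) (t i))) := by
  -- the two arc families
  let R : Fin m → Set (BondConfig (Fin m)) := fun v => {ω | ∀ j : Fin m, j.val < v.val → s(j, j + 1) ∈ ω}
  let L : Fin m → Set (BondConfig (Fin m)) := fun v => {ω | ∀ j : Fin m, v.val ≤ j.val → s(j, j + 1) ∈ ω}
  -- the arc form of the events, valid on configurations of positive weight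
  have harc : ∀ ω : BondConfig (Fin m), bernoulliWeight w ω ≠ 0 → ∀ v : Fin m,
      (ω ∈ openConn (0 : Fin m) v ↔ ω ∈ R v ∪ L v) := by
    intro ω hω v
    refine openConn_iff_arcs (by omega) (fun u u' hadj => ?_) v
    by_cases hne : ∃ k : Fin m, s(u, u') = s(k, k + 1)
    · exact hne
    · exfalso
      rw [openGraph_adj] at hadj
      exact hω (bernoulliWeight_eq_zero_of_mem w hadj.1 (hw _ fun j hj => hne ⟨j, hj⟩))
  -- product moments agree, hence `E_n` agrees
  have hmom : ∀ S : Finset (Fin n),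
      ex (bernoulliWeight w) (∏ i ∈ S, ind (openConn (0 : Fin m) (t i))) =
        ex (bernoulliWeight w) (∏ i ∈ S, ind (R (t i) ∪ L (t i))) := by
    intro S
    rw [ex_def, ex_def]
    refine Finset.sum_congr rfl fun ω _ => ?_
    by_cases hω : bernoulliWeight w ω = 0
    · rw [hω, zero_mul, zero_mul]
    · congr 1
      rw [Finset.prod_apply, Finset.prod_apply]
      refine Finset.prod_congr rfl fun i _ => ?_
      by_cases h : ω ∈ openConn (0 : Fin m) (t i)
      · rw [ind_of_mem h, ind_of_mem ((harc ω hω (t i)).1 h)]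
      · rw [ind_of_not_mem h, ind_of_not_mem (fun h' => h ((harc ω hω (t i)).2 h'))]
  rw [TwoChainUnions.sahiE_congr_of_prodMoments (bernoulliWeight w) (bernoulliWeight w) n _
    (fun i => ind (R (t i) ∪ L (t i))) hmom]
  -- the two-chain theorem
  refine TwoChainUnions.sahiE_nonneg_of_twoChainUnions (bernoulliWeight w)
    (isFKGMeasure_bernoulliWeight w).nonneg (sum_bernoulliWeight w) R L
    (fun v v' h _ hω j hj => hω j (lt_of_lt_of_le hj (Fin.le_def.1 h)))
    (fun v v' h _ hω j hj => hω j (le_trans (Fin.le_def.1 h) hj)) (fun v v' hvv' => ?_) n t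
  have h := real_rightArc_compl_inter_leftArc_compl hm w hvv'
  rw [← ex_bernoulliWeight_ind, ← ex_bernoulliWeight_ind, ← ex_bernoulliWeight_ind] at h
  have hprod : ind ((R v)ᶜ ∩ (L v')ᶜ) = ind (R v)ᶜ * ind (L v')ᶜ := by
    funext ω; exact BHK2006.ind_inter _ _ ω
  rw [hprod] at h
  exact h

/-- **The increasing star on every weighted cycle**: `0 ≤ E₃({0↔b},{0↔c},{0↔y})` for bond percolation on the cycle
`C_m` (`m ≥ 3`, edges `s(j, j+1)`) with arbitrary edge weights and arbitrary targets `b c y`. [this work] -/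
theorem incStar_cycle_nonneg (hm : 3 ≤ m) (w : Sym2 (Fin m) → unitInterval)
    (hw : ∀ e : Sym2 (Fin m), (∀ j : Fin m, e ≠ s(j, j + 1)) → w e = 0) (b c y : Fin m) :
    0 ≤ sahiE3 (prodBernoulli w) (openConn (0 : Fin m) b) (openConn 0 c) (openConn 0 y) := by
  rw [← sahiE_three_ind]
  have h := sahiE_rootCluster_cycle_nonneg hm w hw 3 ![b, c, y]
  have hf : (fun i : Fin 3 => ind (openConn (0 : Fin m) ((![b, c, y] : Fin 3 → Fin m) i))) =
      ![ind (openConn (0 : Fin m) b), ind (openConn 0 c), ind (openConn 0 y)] := by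
    funext i; fin_cases i <;> rfl
  rw [hf] at h
  exact h

end IncStarCycle

end Summit.CriticalPhenomena.PercolationContinuityZ3.Theorems
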